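import Literature.Analysis.FluidPDE.BoltzmannEquation

/-!
# Gaussian characteristic functions identify Dirac masses and Maxwellians (helper for `ParityRigidity`)

On a finite-dimensional real inner product space `E` (with its canonical Lebesgue measure
`volume`), the Maxwellian law `M_{1,u,T}(v) dv` (`Literature.Analysis.FluidPDE.localMaxwellian`)
has characteristic function `ξ ↦ exp (i⟪u, ξ⟫) exp (-(T/2)‖ξ‖²)`
(`charFun_withDensity_localMaxwellian`, Gaussian Fourier integral of Mathlib).  Consequently a
probability measure whose characteristic function is `exp (i⟪u, ξ⟫) exp (-θ‖ξ‖²)` with `θ ≥ 0` is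
the Dirac mass at `u` (`θ = 0`) or the Maxwellian law with temperature `2θ`
(`dirac_or_maxwellian_of_charFun_eq`, by `Measure.ext_of_charFun`).

Helper file for item stmt-AtomisticToContinuum-13084 (route JParityClosure, decl `ParityRigidity`).
-/

open MeasureTheory Metric Real Filter Topology Set Complex
open scoped InnerProductSpace ENNReal NNReal Topology

namespace Summit.AtomisticToContinuum.HydrodynamicLimit.Theorems.ParityRigidity

open Literature.Analysis.FluidPDE

variable {E : Type*} [NormedAddCommGroup E] [InnerProductSpace ℝ E] [FiniteDimensional ℝ E]
  [MeasurableSpace E] [BorelSpace E]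

omit [FiniteDimensional ℝ E] [MeasurableSpace E] [BorelSpace E] in
/-- The local Maxwellian `M_{1,u,T}` is continuous in the velocity variable. -/
theorem continuous_localMaxwellian (T : ℝ) (u : E) : Continuous (localMaxwellian 1 T u) := by
  unfold localMaxwellian
  fun_prop

omit [FiniteDimensional ℝ E] [MeasurableSpace E] [BorelSpace E] in
/-- The local Maxwellian `M_{1,u,T}` with `T > 0` is positive. -/
theorem localMaxwellian_pos {T : ℝ} (hT : 0 < T) (u v : E) : 0 < localMaxwellian 1 T u v := by
  unfold localMaxwellian
  have : 0 < 2 * π * T := by positivity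
  positivity

/-- The local Maxwellian `M_{1,u,T}` with `T > 0` is integrable for Lebesgue measure. -/
theorem integrable_localMaxwellian {T : ℝ} (hT : 0 < T) (u : E) :
    Integrable (localMaxwellian 1 T u) (volume : Measure E) := by
  have hb : 0 < (((1 / (2 * T) : ℝ) : ℂ)).re := by
    rw [Complex.ofReal_re]; positivity
  have h := ((GaussianFourier.integrable_cexp_neg_mul_sq_norm_add (V := E) hb 0 0).norm).comp_sub_right u
  have h' := h.const_mul ((2 * π * T) ^ (-(Module.finrank ℝ E : ℝ) / 2))
  refine h'.congr (Eventually.of_forall fun v => ?_)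
  simp only [zero_mul, add_zero, Complex.norm_exp, localMaxwellian, one_mul]
  congr 1
  simp only [neg_mul, Complex.neg_re, Complex.mul_re, Complex.ofReal_re, Complex.ofReal_im,
    zero_mul, sub_zero]
  congr 1
  rw [show ((‖v - u‖ : ℂ) ^ 2).re = ‖v - u‖ ^ 2 by rw [← Complex.ofReal_pow, Complex.ofReal_re]]
  ring

/-- The Maxwellian law `M_{1,u,T} dv` is a finite measure. -/
theorem isFiniteMeasure_withDensity_localMaxwellian {T : ℝ} (hT : 0 < T) (u : E) :
    IsFiniteMeasure ((volume : Measure E).withDensity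
      fun v => ENNReal.ofReal (localMaxwellian 1 T u v)) :=
  isFiniteMeasure_withDensity_ofReal (integrable_localMaxwellian hT u).hasFiniteIntegral

/-- **Characteristic function of a Maxwellian law**:
`∫ e^{i⟪v,ξ⟫} M_{1,u,T}(v) dv = e^{i⟪u,ξ⟫} e^{-(T/2)‖ξ‖²}` (Gaussian Fourier integral). -/
theorem charFun_withDensity_localMaxwellian {T : ℝ} (hT : 0 < T) (u ξ : E) :
    charFun ((volume : Measure E).withDensity fun v => ENNReal.ofReal (localMaxwellian 1 T u v)) ξ =
      cexp ((⟪u, ξ⟫_ℝ : ℂ) * I) * (Real.exp (-(T / 2) * ‖ξ‖ ^ 2) : ℂ) := by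
  rw [charFun_apply, integral_withDensity_eq_integral_toReal_smul₀
    ((continuous_localMaxwellian T u).measurable.ennreal_ofReal.aemeasurable)
    (Eventually.of_forall fun _ => ENNReal.ofReal_lt_top)]
  simp_rw [ENNReal.toReal_ofReal (localMaxwellian_pos hT u _).le]
  rw [← integral_add_right_eq_self (μ := (volume : Measure E)) _ u]
  -- the integrand after the shift `v = w + u`
  set b : ℂ := ((1 / (2 * T) : ℝ) : ℂ) with hb
  have hbre : 0 < b.re := by rw [hb, Complex.ofReal_re]; positivity
  set C : ℂ := (((2 * π * T) ^ (-(Module.finrank ℝ E : ℝ) / 2) : ℝ) : ℂ) * cexp ((⟪u, ξ⟫_ℝ : ℂ) * I)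
    with hC
  have hI : ∀ w : E, localMaxwellian 1 T u (w + u) • cexp ((⟪w + u, ξ⟫_ℝ : ℂ) * I) =
      C * cexp (-b * (‖w‖ : ℂ) ^ 2 + I * (⟪ξ, w⟫_ℝ : ℂ)) := by
    intro w
    simp only [localMaxwellian, one_mul, add_sub_cancel_right, Complex.real_smul, hC, hb]
    rw [inner_add_left, real_inner_comm ξ w]
    have hT0 : (T : ℂ) ≠ 0 := by exact_mod_cast hT.ne'
    push_cast
    rw [mul_assoc, ← Complex.exp_add]
    conv_rhs => rw [mul_assoc, ← Complex.exp_add]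
    congr 1
    congr 1
    field_simp
    ring
  simp_rw [hI, integral_const_mul]
  have key : ∀ x P Q R : ℂ, x * P * (Q * R) = (x * Q) * (P * R) := by intros; ring
  rw [GaussianFourier.integral_cexp_neg_mul_sq_norm_add hbre I ξ, hC, key]
  have hconst : (((2 * π * T) ^ (-(Module.finrank ℝ E : ℝ) / 2) : ℝ) : ℂ) *
      ((π : ℂ) / b) ^ ((Module.finrank ℝ E : ℂ) / 2) = 1 := by
    have h2 : ((π : ℂ) / b) ^ ((Module.finrank ℝ E : ℂ) / 2) =
        (((2 * π * T) ^ ((Module.finrank ℝ E : ℝ) / 2) : ℝ) : ℂ) := by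
      have hpos : (0 : ℝ) ≤ 2 * π * T := by positivity
      rw [Complex.ofReal_cpow hpos]
      push_cast
      congr 1
      rw [hb]
      push_cast
      field_simp
    rw [h2, ← Complex.ofReal_mul, neg_div, rpow_neg (by positivity),
      inv_mul_cancel₀ (rpow_pos_of_pos (by positivity) _).ne', Complex.ofReal_one]
  rw [hconst, one_mul, Complex.I_sq]
  congr 1
  rw [Complex.ofReal_exp]
  congr 1
  rw [hb]
  have hT0 : (T : ℂ) ≠ 0 := by exact_mod_cast hT.ne'
  push_cast
  field_simp
  ring

/-- **Identification.** A probability measure whose characteristic function is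
`ξ ↦ exp (i⟪u, ξ⟫) exp (-θ‖ξ‖²)` with `θ ≥ 0` is the Dirac mass at `u` (if `θ = 0`) or the
Maxwellian law `M_{1,u,2θ}(v) dv` (if `θ > 0`). -/
theorem dirac_or_maxwellian_of_charFun_eq (m : Measure E) [IsProbabilityMeasure m] {θ : ℝ}
    (hθ : 0 ≤ θ) (u : E)
    (hφ : ∀ ξ, charFun m ξ = cexp ((⟪u, ξ⟫_ℝ : ℂ) * I) * (Real.exp (-θ * ‖ξ‖ ^ 2) : ℂ)) :
    (∃ u : E, m = Measure.dirac u) ∨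
      ∃ T : ℝ, ∃ u : E, 0 < T ∧
        m = (volume : Measure E).withDensity fun v => ENNReal.ofReal (localMaxwellian 1 T u v) := by
  rcases hθ.eq_or_lt with h0 | hpos
  · left
    refine ⟨u, Measure.ext_of_charFun (funext fun ξ => ?_)⟩
    rw [hφ ξ, charFun_dirac, ← h0]
    simp
  · right
    haveI := isFiniteMeasure_withDensity_localMaxwellian (E := E) (by positivity : 0 < 2 * θ) u
    refine ⟨2 * θ, u, by positivity, Measure.ext_of_charFun (funext fun ξ => ?_)⟩
    rw [hφ ξ, charFun_withDensity_localMaxwellian (by positivity) u ξ]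
    congr 3
    ring

end Summit.AtomisticToContinuum.HydrodynamicLimit.Theorems.ParityRigidity
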